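/- Free lead seat `ym-line-cbag-p1` (prover-ym-line-cbag-p1-g20-0; own crux `BoxFloorAllGroups` stmt-QuantumFields-22254 of route
`ColdBoxAllGroups` CLOSED) working the planner-of-record's LINE 5, route `HankelDensitySplitting`: support item
stmt-QuantumFields-26619 `TorusLimitTransfer`.  RECORD-type material (the node `LatticeNonFreezing`); the Yang–Mills mass gap is NOT
proved by anything here. -/
import Summits.QuantumFields.YangMills.Theses.HankelDensitySplitting
import Literature.Barriers.QuantumFields.AbelianDeconfinementD4Proofs
import Summits.QuantumFields.YangMills.Theorems.ColdBoxAllGroupsBoxAllPairsCoreG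
import Literature.MathematicalPhysics.QuantumLattice.LatticeGaugeDLRLimitPointsProofs
import Literature.MathematicalPhysics.QuantumFieldTheory.LatticeGaugeProofs
import Literature.Probability.LatticeModels.LoewnerAssociation

/-!
# Route `HankelDensitySplitting`, support item `TorusLimitTransfer` (stmt-QuantumFields-26619): torus bounds on the
six-plane density time correlator pass to an infinite-volume limit state

**Statement** (`Summit.QuantumFields.YangMills.Theses.HankelDensitySplitting.TorusLimitTransfer`, with `K = 1`).  For every
compact simple `G` and faithful unitary lattice representation `r`, all `β, C, m`: if along infinitely many ODD tori `2S+1` the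
connected time correlator of the six-plane action density `r.curvature.F = Σ_{i<j} Re tr r.ρ(U_{p_{ij}(0)})`
(`latticeConnectedCorr r.ρ β (2S+1) F F n`, Wilson measure at coupling `β`) satisfies `|…| ≤ C e^{−m n}` for all `n ≤ S`, then some
`μ ∈ infiniteVolumeLimitPoints r.ρ β` has `|f_μ(n)| ≤ C e^{−m n}` for all `n`, where
`f_μ(n) = Σ_{i<j} Σ_{k<l} plaquetteCorr r.ρ μ 0 i j (n e₀) k l` is the 36-pair density–density truncated correlator of the
limit state (written as the `if … then … else 0` sum over `Fin 4` of the route file).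

**Proof.**
1. The good sides `S` are frequent, so a strictly increasing sequence `φ₀` of them exists (`Filter.extraction_of_frequently_atTop`).
2. Compactness along the prescribed tori `2φ₀(k)+1` (`exists_isInfiniteVolumeLimitAlong_comp`, the argument of the tree's
   `infiniteVolumeLimitPoints_nonempty_holds` run along a prescribed sequence; Seiler LNP 159 Ch. 2 «by compactness»): a further
   subsequence of the torus Wilson states converges on bounded continuous cylinder observables to a probability measure `μ`, and
   `μ ∈ infiniteVolumeLimitPoints r.ρ β`.
3. For fixed `n`, `latticeConnectedCorr r.ρ β (2S+1) F F n = E_S[F · F∘θ_{−n e₀}] − E_S[F]·E_S[F∘θ_{−n e₀}]` (translation invariance of the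
   torus state, `wilsonExpectation_comp_torusConfigShift`), and the three torus expectations of these bounded continuous cylinder
   observables converge along the subsequence; the bound `C e^{−m n}` holds for all large indices, hence for the limit
   `Cov_μ(F, F∘θ_{−n e₀})` (`le_of_tendsto`).
4. Bilinearity of the covariance under the probability measure `μ` (tree `ColdBoxAllGroups.cov_sum_sum_eq`) and
   `Re tr ρ(U_{(0;k,l)})(θ_{−n e₀}U) = Re tr ρ(U_{(n e₀;k,l)})(U)` (tree `Literature.Barriers.QuantumFields.plaquetteObs_configShift`)
   identify `Cov_μ(F, F∘θ_{−n e₀})` with the 36-pair sum `f_μ(n)` (`sum_plaquetteCorr_eq_cov`).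

Sources: E. Seiler, LNP 159 (1982) Ch. 2; K. Osterwalder, E. Seiler, Ann. Phys. 110 (1978) §2; S. Chatterjee, arXiv:1803.01950 §2
and Problem 5.1.  Bookkeeping/compactness only; no expansion.  NOT the Yang–Mills mass gap; the node `LatticeNonFreezing` is not
proved here either.
-/

noncomputable section

open MeasureTheory Filter Topology
open Literature.MathematicalPhysics.QuantumFieldTheory
open Literature.MathematicalPhysics.QuantumLattice

namespace Summit.QuantumFields.YangMills.Theorems.HankelDensitySplitting

/-! ### Compactness along a prescribed sequence of tori -/

section Compactness

variable {d N : ℕ} {G : Type} [Group G] [TopologicalSpace G] [IsTopologicalGroup G]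
  [CompactSpace G] [MeasurableSpace G] [BorelSpace G] [T2Space G] [SecondCountableTopology G]
  (ρ : G →* Matrix (Fin N) (Fin N) ℂ)

-- adapted from `CentreDominatedStringTension.exists_isInfiniteVolumeLimitAlong_comp`
-- (Literature/MathematicalPhysics/QuantumFieldTheory/CentreDominatedStringTension.lean), restated to keep imports small
/-- **Compactness along a prescribed sequence of tori.** For a continuous representation `ρ` of the compact second-countable
Hausdorff group `G`, every `β` and every strictly increasing sequence of torus sizes `Ls`, there are a subsequence `Ls ∘ φ` and a
probability measure `ν` on `G^{edges(ℤ^d)}` such that the torus Wilson states `μ_{Λ_{Ls(φ k)+1}, β}` converge to `ν` on all bounded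
continuous cylinder observables (`IsInfiniteVolumeLimitAlong ρ β (Ls ∘ φ) ν`); in particular `ν ∈ infiniteVolumeLimitPoints ρ β`
(Seiler LNP 159 Ch. 2; Chatterjee arXiv:1803.01950 §2 «by compactness»). [folklore] -/
theorem exists_isInfiniteVolumeLimitAlong_comp (hρ : Continuous ρ) (β : ℝ) {Ls : ℕ → ℕ} (hLs : StrictMono Ls) :
    ∃ ν : Measure (LGConfig d G), ∃ φ : ℕ → ℕ, StrictMono φ ∧
      IsInfiniteVolumeLimitAlong ρ β (Ls ∘ φ) ν ∧ ν ∈ infiniteVolumeLimitPoints ρ β := by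
  haveI := fun L : ℕ => isProbabilityMeasure_torusState (d := d) (L := L + 1) ρ hρ β
  let P : ℕ → ProbabilityMeasure (LGConfig d G) :=
    fun k => ⟨torusState ρ β (Ls k + 1), inferInstance⟩
  obtain ⟨ν, -, φ, hφ, hlim⟩ :=
    (isCompact_univ (X := ProbabilityMeasure (LGConfig d G))).tendsto_subseq
      fun n => Set.mem_univ (P n)
  have hconv : IsInfiniteVolumeLimitAlong ρ β (Ls ∘ φ) (ν : Measure (LGConfig d G)) := by
    refine ⟨inferInstance, fun F S _ hFc hFb => ?_⟩
    obtain ⟨C, hC⟩ := hFb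
    let Fb : BoundedContinuousFunction (LGConfig d G) ℝ :=
      BoundedContinuousFunction.ofNormedAddCommGroup F hFc C
        (fun U => by simpa [Real.norm_eq_abs] using hC U)
    have hE : (fun k : ℕ => wilsonExpectation (L := (Ls ∘ φ) k + 1) ρ β
        (toTorusObservable ((Ls ∘ φ) k + 1) F)) =
        fun k => ∫ U, Fb U ∂(P (φ k) : Measure (LGConfig d G)) :=
      funext fun k => wilsonExpectation_toTorusObservable ρ β (Ls (φ k) + 1) hFc.measurable
    have key : Tendsto (fun k : ℕ => ∫ U, Fb U ∂(P (φ k) : Measure (LGConfig d G))) atTop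
        (𝓝 (∫ U, Fb U ∂(ν : Measure (LGConfig d G)))) :=
      (ProbabilityMeasure.tendsto_iff_forall_integral_tendsto.1 hlim) Fb
    rw [hE]
    exact key
  exact ⟨ν, φ, hφ, hconv, ⟨Ls ∘ φ, hLs.comp hφ, hconv⟩⟩

end Compactness

/-! ### The 36-pair sum as one covariance of the limit state -/

section Density

variable {N : ℕ} {G : Type} [Group G] [TopologicalSpace G] [IsTopologicalGroup G]
  [MeasurableSpace G] [BorelSpace G] [SecondCountableTopology G]

/-- The time-axis site `n e₀` is `0 − (−n e₀)` in the `Pi.single` spellings of the route file and of `latticeConnectedCorr`. -/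
theorem zero_sub_neg_single (n : ℕ) :
    (0 : Literature.Probability.LatticeModels.Site 4) - -Pi.single (0 : Fin 4) (n : ℤ) =
      (n : ℤ) • Pi.single (0 : Fin 4) (1 : ℤ) := by
  rw [zero_sub, neg_neg]
  ext i
  by_cases hi : i = 0
  · subst hi
    simp
  · simp [hi]

/-- **The 36-pair density correlator of a probability state is the covariance of the six-plane density with its time translate.**
For a continuous unitary `ρ` and a probability measure `μ` on `G^{edges(ℤ⁴)}`,
`Σ_{i<j} Σ_{k<l} plaquetteCorr ρ μ 0 i j (n e₀) k l = ∫ F · (F∘θ_{−n e₀}) dμ − (∫ F dμ)(∫ F∘θ_{−n e₀} dμ)` with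
`F = actionDensity ρ = Σ_{i<j} Re tr ρ(U_{p_{ij}(0)})` — bilinearity of the covariance and
`Re tr ρ(U_{(0;k,l)})(θ_{−n e₀} U) = Re tr ρ(U_{(n e₀;k,l)})(U)`. [folklore] -/
theorem sum_plaquetteCorr_eq_cov (ρ : G →* Matrix (Fin N) (Fin N) ℂ) (hρ : Continuous ρ)
    (hρu : ∀ g, ρ g ∈ Matrix.unitaryGroup (Fin N) ℂ) (μ : Measure (LGConfig 4 G)) [IsProbabilityMeasure μ] (n : ℕ) :
    (∑ i : Fin 4, ∑ j : Fin 4, ∑ k : Fin 4, ∑ l : Fin 4,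
        if i < j ∧ k < l then plaquetteCorr ρ μ 0 i j ((n : ℤ) • Pi.single (0 : Fin 4) (1 : ℤ)) k l else 0) =
      (∫ U, actionDensity ρ U * actionDensity ρ (configShift (-Pi.single (0 : Fin 4) (n : ℤ)) U) ∂μ) -
        (∫ U, actionDensity ρ U ∂μ) * ∫ U, actionDensity ρ (configShift (-Pi.single (0 : Fin 4) (n : ℤ)) U) ∂μ := by
  set x : Literature.Probability.LatticeModels.Site 4 := (n : ℤ) • Pi.single (0 : Fin 4) (1 : ℤ) with hx
  set v : Literature.Probability.LatticeModels.Site 4 := -Pi.single (0 : Fin 4) (n : ℤ) with hv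
  have h0v : (0 : Literature.Probability.LatticeModels.Site 4) - v = x := by
    rw [hv, hx]; exact zero_sub_neg_single n
  -- the density and its translate as sums over ordered index pairs
  have hF : ∀ U : LGConfig 4 G, actionDensity ρ U =
      ∑ p : Fin 4 × Fin 4, (if p.1 < p.2 then plaquetteObs ρ 0 p.1 p.2 U else 0) := by
    intro U
    rw [actionDensity, Fintype.sum_prod_type]
  have hFx : ∀ U : LGConfig 4 G, actionDensity ρ (configShift v U) =
      ∑ p : Fin 4 × Fin 4, (if p.1 < p.2 then plaquetteObs ρ x p.1 p.2 U else 0) := by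
    intro U
    rw [actionDensity, Fintype.sum_prod_type]
    simp only [Literature.Barriers.QuantumFields.plaquetteObs_configShift, h0v]
  simp only [hFx]
  simp only [hF]
  -- integrability of the (bounded measurable) summands
  have hmeas : ∀ (y : Literature.Probability.LatticeModels.Site 4) (p : Fin 4 × Fin 4),
      Measurable fun U : LGConfig 4 G => if p.1 < p.2 then plaquetteObs ρ y p.1 p.2 U else 0 := by
    intro y p
    by_cases hp : p.1 < p.2
    · simp only [hp, if_true]; exact measurable_plaquetteObs ρ hρ y p.1 p.2
    · simp only [hp, if_false]; exact measurable_const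
  have hbdd : ∀ (y : Literature.Probability.LatticeModels.Site 4) (p : Fin 4 × Fin 4) (U : LGConfig 4 G),
      |(if p.1 < p.2 then plaquetteObs ρ y p.1 p.2 U else 0)| ≤ N := by
    intro y p U
    by_cases hp : p.1 < p.2
    · simp only [hp, if_true]; exact abs_plaquetteObs_le_holds (G := G) ρ hρu y p.1 p.2 U
    · simp only [hp, if_false, abs_zero]; exact Nat.cast_nonneg N
  have hint : ∀ (y : Literature.Probability.LatticeModels.Site 4) (p : Fin 4 × Fin 4),
      Integrable (fun U : LGConfig 4 G => if p.1 < p.2 then plaquetteObs ρ y p.1 p.2 U else 0) μ :=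
    fun y p => Literature.Probability.LatticeModels.integrable_of_measurable_of_abs_le (hmeas y p) (hbdd y p)
  have hint2 : ∀ (p q : Fin 4 × Fin 4),
      Integrable (fun U : LGConfig 4 G => (if p.1 < p.2 then plaquetteObs ρ 0 p.1 p.2 U else 0) *
        (if q.1 < q.2 then plaquetteObs ρ x q.1 q.2 U else 0)) μ := fun p q =>
    Literature.Probability.LatticeModels.integrable_of_measurable_of_abs_le ((hmeas 0 p).mul (hmeas x q))
      (C := (N : ℝ) * N) fun U => by
      rw [abs_mul]
      exact mul_le_mul (hbdd 0 p U) (hbdd x q U) (abs_nonneg _) (Nat.cast_nonneg N)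
  rw [ColdBoxAllGroups.cov_sum_sum_eq μ _ _ (hint 0) (hint x) hint2, Fintype.sum_prod_type]
  refine Finset.sum_congr rfl fun i _ => Finset.sum_congr rfl fun j _ => ?_
  rw [Fintype.sum_prod_type]
  refine Finset.sum_congr rfl fun k _ => Finset.sum_congr rfl fun l _ => ?_
  by_cases hij : i < j
  · by_cases hkl : k < l
    · simp only [hij, hkl, and_self, if_true, plaquetteCorr]
    · simp only [hij, hkl, and_false, if_true, if_false, mul_zero, integral_zero, sub_zero]
  · simp only [hij, false_and, if_false, zero_mul, integral_zero, sub_zero]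

end Density

/-! ### The item -/

/-- **Item stmt-QuantumFields-26619 (`TorusLimitTransfer`, route `HankelDensitySplitting`), proved with `K = 1`.**  If along
infinitely many odd tori `2S+1` the connected time correlator of the six-plane density `r.curvature.F` obeys
`|latticeConnectedCorr r.ρ β (2S+1) F F n| ≤ C e^{−m n}` for all `n ≤ S`, then some infinite-volume limit point
`μ ∈ infiniteVolumeLimitPoints r.ρ β` (the limit of the torus Wilson states along a subsequence of exactly these tori, by compactness:
`exists_isInfiniteVolumeLimitAlong_comp`) has `|Σ_{i<j} Σ_{k<l} plaquetteCorr r.ρ μ 0 i j (n e₀) k l| ≤ C e^{−m n}`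
for every `n`: the torus correlator is `E[F·F∘θ] − E[F]E[F∘θ]` of bounded continuous cylinder observables (translation invariance of the
torus state for the second mean), these expectations converge along the subsequence, and the limit covariance is the 36-pair sum
(`sum_plaquetteCorr_eq_cov`).  Seiler LNP 159 Ch. 2; Chatterjee arXiv:1803.01950 §2.  NOT the Yang–Mills mass gap. -/
theorem torusLimitTransfer_proof :
    Summit.QuantumFields.YangMills.Theses.HankelDensitySplitting.TorusLimitTransfer := by
  intro G _ _ _ _ _ _ _ r
  refine ⟨1, one_pos, ?_⟩
  intro β C m h
  haveI : SecondCountableTopology G :=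
    (r.continuous.isClosedEmbedding r.injective).isEmbedding.secondCountableTopology
  haveI : T2Space G := (r.continuous.isClosedEmbedding r.injective).isEmbedding.t2Space
  -- 1. a strictly increasing sequence of good torus half-sides
  have hfreq : ∃ᶠ S : ℕ in atTop, ∀ n : ℕ, n ≤ S →
      |latticeConnectedCorr r.ρ β (2 * S + 1) r.curvature.F r.curvature.F n| ≤ C * Real.exp (-(m * n)) :=
    frequently_atTop.2 h
  obtain ⟨φ₀, hφ₀, hgood⟩ := extraction_of_frequently_atTop hfreq
  -- 2. compactness along the tori `2 φ₀ k + 1`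
  have hLs : StrictMono fun k : ℕ => 2 * φ₀ k := fun a b hab => by
    have := hφ₀ hab
    dsimp only
    omega
  obtain ⟨μ, φ, hφ, hconv0, hmem⟩ :=
    exists_isInfiniteVolumeLimitAlong_comp (d := 4) r.ρ r.continuous β hLs
  have hconv : IsInfiniteVolumeLimitAlong (d := 4) r.ρ β (fun k => 2 * φ₀ (φ k)) μ := hconv0
  haveI : IsProbabilityMeasure μ := hconv.1
  refine ⟨μ, hmem, fun n => ?_⟩
  rw [one_mul]
  -- notation
  set F : LGConfig 4 G → ℝ := r.curvature.F with hFdef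
  set v : Literature.Probability.LatticeModels.Site 4 := -Pi.single (0 : Fin 4) (n : ℤ) with hv
  have hFact : F = actionDensity r.ρ := rfl
  have hFc : Continuous F := continuous_actionDensity r.continuous
  obtain ⟨CF, hCF⟩ := r.curvature.bounded
  have hFcyl := r.curvature.isCylinder
  -- 3. the three torus expectations converge along `k ↦ φ₀ (φ k)`
  have hΨcyl : IsCylinder (fun U => F U * F (configShift v U)) _ :=
    IsCylinder.mul hFcyl (IsCylinder.comp_configShift hFcyl v)
  have hΨc : Continuous fun U => F U * F (configShift v U) := hFc.mul (hFc.comp (continuous_configShift v))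
  have hΨb : ∃ C', ∀ U, |F U * F (configShift v U)| ≤ C' :=
    ⟨CF * CF, fun U => by
      rw [abs_mul]
      exact mul_le_mul (hCF U) (hCF _) (abs_nonneg _) ((abs_nonneg _).trans (hCF U))⟩
  have t1 := hconv.2 _ _ hΨcyl hΨc hΨb
  have t2 := hconv.2 F _ hFcyl hFc ⟨CF, hCF⟩
  have t3 := hconv.2 (F ∘ configShift v) _ (IsCylinder.comp_configShift hFcyl v)
    (hFc.comp (continuous_configShift v)) ⟨CF, fun U => hCF _⟩
  -- translation invariance of the torus states: the shifted mean is the unshifted one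
  have hE : (fun k : ℕ => wilsonExpectation (L := 2 * φ₀ (φ k) + 1) r.ρ β
        (toTorusObservable (2 * φ₀ (φ k) + 1) (F ∘ configShift v))) =
      fun k : ℕ => wilsonExpectation (L := 2 * φ₀ (φ k) + 1) r.ρ β
        (toTorusObservable (2 * φ₀ (φ k) + 1) F) := by
    funext k
    rw [toTorusObservable_comp_configShift, wilsonExpectation_comp_torusConfigShift]
  rw [hE] at t3
  have T : Tendsto (fun k : ℕ => latticeConnectedCorr r.ρ β (2 * φ₀ (φ k) + 1) F F n) atTop
      (𝓝 ((∫ U, F U * F (configShift v U) ∂μ) - (∫ U, F U ∂μ) * ∫ U, (F ∘ configShift v) U ∂μ)) := by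
    have T0 := t1.sub (t2.mul t3)
    refine (tendsto_congr fun k => ?_).1 T0
    simp only [latticeConnectedCorr, wilsonExpectation, toTorusObservable_apply, hv]
  -- the bound holds for all large indices of the subsequence
  have hev : ∀ᶠ k : ℕ in atTop,
      |latticeConnectedCorr r.ρ β (2 * φ₀ (φ k) + 1) F F n| ≤ C * Real.exp (-(m * n)) := by
    refine (eventually_ge_atTop n).mono fun k hk => ?_
    exact hgood (φ k) n (hk.trans ((hφ₀.comp hφ).le_apply (x := k)))
  have key := le_of_tendsto T.abs hev
  -- 4. the limit covariance is the 36-pair sum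
  have hid := sum_plaquetteCorr_eq_cov r.ρ r.continuous r.mem_unitary μ n
  rw [hid]
  simpa only [hFact, Function.comp_apply, hv] using key

end Summit.QuantumFields.YangMills.Theorems.HankelDensitySplitting

end
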